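import Literature.NumberTheory.LFunctions.YoshidaWindowGramColumnData
import HarnessLib

/-!
# C∞ rung `R1E` (even sector) — DATA `IP` part 1/1

Route context: Fourier–Galerkin / Schur-complement certificates of Weil positivity on a window ("format C", C∞ door `weilPositivityOn_of_cinf_pipeline`); supporting stmt-RiemannHypothesis-0098; seat rh-explicit-weil-2 (`cinfemit.py`/`emit_lean2.py`, HOME/rh-explicit-weil-2/gen17/EMITTER-PHASE2.md). Data / bookkeeping only; standard axioms; no RH claim.
-/

set_option autoImplicit false
-- `Summit.RiemannHypothesis.RiemannHypothesis.…` is the layout-mandated namespace (summit = problem name).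
set_option linter.dupNamespace false

namespace Summit.RiemannHypothesis.RiemannHypothesis.Theorems.WeilFormatC

open Literature.NumberTheory.LFunctions

namespace CinfR1E

/-- Packed rows part 1/1 of table `IP` (word width 369, 4 words). -/
def IP_P : List ℕ := [
  0x7fffffffffcaee304f66d0bf65626201d3a9f4cdd88070c13a9f4cdd88070c13a9f4cdd88070c13a9f4cdd88070c40000000000000b049c7454fcd4856f4b493d4e036bd9a65493d4e036bd9a65493d4e036bd9a65493d4e036bd9a65ffffffffffffffffdd54db6cfbe81c5982e1a2773eb9bd102e1a2773eb9bd102e1a2773eb9bd102e1a2773eb9bd3000000000000000000005d18f8b440f3d00d00d00d00d00d00d00d00d00d00d00d00d00d00d00d00d00d00d00d01,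
  0x80000009e682450543d7878fc3f653ef62303d068d544c5ec8a9760e7aea6b92303d068d544c5ec8a9760e7aea6bbfffffffffdf1d8006f27c43f21aaea521a59a59a59a59a59a59a59a59a59a59a59a59a59a59a59a59a59a59a59a60000000000000676fd0eb0194de1eba5d4ed2046617d5da74ed2046617d5da74ed2046617d5da74ed2046617d5daffffffffffffffffeeaa6db67df40e2cc170d13b9f5cde88170d13b9f5cde88170d13b9f5cde88170d13b9f5cde9,
  0x7ffe6d123ae546a832e6d478300a14f2fe7c4627ac0b5c578712d95d6d7d7fb96ecce44dba84c3512dcbe42a1f2f400000053a524960ea25ddc7eafd9ca2061a986bec0cc903529a77afb1bd81261a986bec0cc903529a77afb1bd815fffffffffef8ec003793e21f90d575290d2cd2cd2cd2cd2cd2cd2cd2cd2cd2cd2cd2cd2cd2cd2cd2cd2cd2cd2cd300000000000002c1271d153f35215bd2d24f5380daf6699524f5380daf6699524f5380daf6699524f5380daf6699,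
  0xbca7bda7e1e1dd692fd65e314f827bab609a8b354606ebc7dd466bff925d4cbd3c3a5db1d106ba64030daebac9173fff36891d72a35419736a3c18050a797f3e2313d605ae2bc3896caeb6bebfdcb7667226dd4261a896e5f2150f97a000000279a0914150f5e1e3f0fd94fbd88c0f41a3551317b22a5d839eba9ae48c0f41a3551317b22a5d839eba9aeffffffffff95dc609ecda17ecac4c403a753e99bb100e182753e99bb100e182753e99bb100e182753e99bb100e18]

end CinfR1E

end Summit.RiemannHypothesis.RiemannHypothesis.Theorems.WeilFormatC
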